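import Literature.MathematicalPhysics.QuantumFieldTheory.Balaban1983to89.Node00.OpsYLeibnizLetters

/-!
# NODE 00 — def-Y FILE 38: pointwise STENCIL SIZES and SEMI-LOCALITY of the direction letters of `K(h)` and of the Leibniz rules

[B9] = Balaban, *Propagators for lattice gauge theories in a background field*, CMP 99 (1985), (3.88)–(3.89) p.409, p.410 («the operator
K(h) is semi-local»), (3.100) p.413; [4] = Balaban, *Propagators and renormalization transformations II*, CMP 96 (1984), (2.39)–(2.40) pp.229–230.

WHAT.  FILE 37 (`Node00.OpsYLeibnizLetters`) split print's `K(h_□) = Σ_b(∂h)(b)(D_Uλ)(b) + (Δh)λ + (averaging line)` into ONE LETTER PER LATTICE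
DIRECTION: `K(h) = Σ_μ P_μ∘∇_{U,μ} + C` (`pKY`, `cKY`), `K(h) = −(Σ_μ ∇*_{U,μ}∘Pt_μ + Ct)` (`ptKY`, `ctKY`), the Leibniz letters `M_{∂⁺_μh}`
(`cutMulY (fdiffY h μ)`), `C^{Lt}_μ` (`cltY`) and the averaging line `kavgY`.  The rows-18–19 schema over the direction letters (`Identities₂`:
`hP : ∀ i μ, HasMajorant blk (P U i μ) (K i μ)`, …) asks, letter by letter, for the two facts print compresses into «K(h) is semi-local» and the
factor `O(M⁻¹)` of (3.89): (i) the value `(letter Λ)(z)` depends on `Λ` only on the STENCIL of `z` (the site, its lattice neighbours `z ± e_μ`, the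
block of `z`), and (ii) its norm is at most `(first ∕ second differences of h at z) × (sup of ‖Λ‖ over that stencil)` — for bond variables and
averaging transporters that are CONTRACTION PAIRS (`‖u‖ ≤ 1 ∧ ‖u⁻¹‖ ≤ 1`, print's `U(b) ∈ G ⊂ U(N)`), exactly the convention of
`B9Thm37CubeCoverCommutatorSizes.norm_KhY_apply_le` (which is the SUM of the present per-letter sizes).
* §1 the letters EVALUATED (`pKY_apply`, `ptKY_apply`, `cltY_apply`, `kavgY_apply`, `cKY_apply`, `ctKY_apply`);
* §2 POINTWISE SIZES: `norm_cutMulY_apply` (`‖M_fΛ(z)‖ = |f z|‖Λ z‖`), `norm_pKY_apply_le` (`≤ |∂⁺_μh(z)|‖Λ z‖ + |∂⁻̃_μh(z)|‖Λ(z−e_μ)‖`),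
  `norm_ptKY_apply_le` (`≤ |∂⁺_μh(z)|(‖Λ(z+e_μ)‖ + ‖Λ z‖)`), `norm_cltY_apply_le` (`≤ |∂⁻̃_μh(z)|‖Λ(z−e_μ)‖`), `norm_kavgY_apply_le`
  (`≤ Σ_w |avgCoeffY(z,w)||h z − h w|‖Λ w‖`), `norm_cKY_apply_le`, `norm_ctKY_apply_le` (`≤ |Δh(z)|‖Λ z‖ + averaging line`);
* §3 the same against ONE local bound `B` of `‖Λ‖` over the stencil (`…_le_of_bound`: `≤ (|∂⁺_μh z| + |∂⁻̃_μh z|)·B`, `≤ 2|∂⁺_μh z|·B`, …);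
* §4 SEMI-LOCALITY: each letter at `z` is unchanged when `Λ` is changed off the stencil of `z` (`…_apply_congr`), and VANISHES at `z` when the
  relevant differences of `h` vanish there (`…_apply_eq_zero`) — the output of every letter lives on the support of `∂h ∕ Δh ∕ (h z − h w)`.

HONEST SCOPE.  Pointwise algebra and the triangle inequality only: NO located numbers (`O(M⁻¹)`, `(MLʲη)⁻¹`, the kernels `kP, kC` and stencils
`S′` of the rows-18–19 record are the N06 lanes' — they follow from §3 and the Lipschitz sizes of the cube cut-offs `hTY`,
`B6Partition118KLevelTorusBinders.abs_hT_sub_le_near`), no (3.42), no regime.  Contraction pairs are HYPOTHESES on `UboxY i U μ` ∕ `avgTrY i par U z`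
(as in `B9Thm37CubeCoverCommutatorSizes`; equalities for unitary bond variables).  Nothing continuum ∕ OS ∕ mass-gap ∕ Clay; YM mass gap NOT proved
by any of this.  `--supports stmt-QuantumFields-20541`.  Net new unproved facts: 0.
-/

namespace Literature.MathematicalPhysics.QuantumFieldTheory.Balaban1983to89.Node00.OpsYLeibnizLettersSizes

open B6KLevelCensusIndexV1 (KIdx)
open B9Eq39Adjoint (R R_add R_sub R_smul R_zero)
open B9Thm37CubeCoverCommutators (cutMulY cutMulY_apply stencilY self_mem_stencilY shiftY_mem_stencilY shiftY_symm_mem_stencilY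
  mem_stencilY_of_avgCoeffY_ne_zero)
open B9Thm37CubeCoverCommutatorSizes (norm_R_le_of_pair norm_ofReal_smul)
open OpsYLeibnizLetters (fdiffY bdiffY lapDiffY fdiffY_apply bdiffY_apply fshiftSL bshiftSL fshiftSL_apply bshiftSL_apply cltY pKY ptKY kavgY cKY ctKY)

variable {𝔸 : Type} [NormedRing 𝔸] [NormedAlgebra ℂ 𝔸] [CompleteSpace 𝔸]

/-! ## §0 The size of a cut-off multiplication -/

omit [CompleteSpace 𝔸] in
/-- `‖(M_fΛ)(z)‖ = |f z|·‖Λ z‖`. [cite: Balaban1985BackgroundPropagators, (3.87) p.409, bookkeeping] -/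
theorem norm_cutMulY_apply {X : Type} (f : X → ℝ) (Λ : X → 𝔸) (z : X) : ‖cutMulY (𝔸 := 𝔸) f Λ z‖ = |f z| * ‖Λ z‖ := by
  rw [cutMulY_apply, norm_ofReal_smul]

omit [CompleteSpace 𝔸] in
/-- semi-locality of `M_f`: `(M_fΛ)(z)` depends on `Λ z` only. [cite: Balaban1985BackgroundPropagators, (3.87) p.409, bookkeeping] -/
theorem cutMulY_apply_congr {X : Type} (f : X → ℝ) {Λ Λ' : X → 𝔸} {z : X} (hΛ : Λ z = Λ' z) :
    cutMulY (𝔸 := 𝔸) f Λ z = cutMulY (𝔸 := 𝔸) f Λ' z := by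
  rw [cutMulY_apply, cutMulY_apply, hΛ]

omit [CompleteSpace 𝔸] in
/-- `(M_fΛ)(z) = 0` where `f z = 0` (the Leibniz letter `M_{∂⁺_μh}` lives on `supp ∂⁺_μh`). [cite: Balaban1985BackgroundPropagators, (3.100) p.413, bookkeeping] -/
theorem cutMulY_apply_eq_zero {X : Type} (f : X → ℝ) (Λ : X → 𝔸) {z : X} (hf : f z = 0) : cutMulY (𝔸 := 𝔸) f Λ z = 0 := by
  rw [cutMulY_apply, hf, Complex.ofReal_zero, zero_smul]

section Letters

variable {d ℓ : ℕ} {hd : 1 ≤ d + 1} {hL : Odd (ℓ + 1) ∧ 1 < ℓ + 1} {b₀ b₁ : ℝ}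
variable (i : KIdx d ℓ hd hL b₀ b₁)

/-! ## §1 The direction letters, evaluated -/

/-- `(P_μΛ)(z) = (∂⁺_μh)(z)Λ(z) − (∂⁻̃_μh)(z)·R(U_μ(z−e_μ))⁻¹Λ(z−e_μ)`. [cite: Balaban1985BackgroundPropagators, (3.88)–(3.89) p.409] -/
theorem pKY_apply (U : CfgY 𝔸 i) (h : SiteY i → ℝ) (μ : Fin (d + 1)) (Λ : SiteY i → 𝔸) (z : SiteY i) :
    pKY i U h μ Λ z = ((fdiffY i h μ z : ℝ) : ℂ) • Λ z
      - ((bdiffY i h μ z : ℝ) : ℂ) • R (UboxY i U μ ((shiftY i μ).symm z))⁻¹ (Λ ((shiftY i μ).symm z)) := by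
  rw [pKY, LinearMap.sub_apply, Pi.sub_apply, Module.End.mul_apply, cutMulY_apply, cutMulY_apply, bshiftSL_apply]

/-- `(Pt_μΛ)(z) = (∂⁺_μh)(z)·(R(U_μ(z))Λ(z+e_μ) + Λ(z))`. [cite: Balaban1985BackgroundPropagators, (3.88)–(3.89) p.409] -/
theorem ptKY_apply (U : CfgY 𝔸 i) (h : SiteY i → ℝ) (μ : Fin (d + 1)) (Λ : SiteY i → 𝔸) (z : SiteY i) :
    ptKY i U h μ Λ z = ((fdiffY i h μ z : ℝ) : ℂ) • (R (UboxY i U μ z) (Λ (shiftY i μ z)) + Λ z) := by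
  rw [ptKY, Module.End.mul_apply, cutMulY_apply, LinearMap.add_apply, Pi.add_apply, fshiftSL_apply, Module.End.one_apply]

/-- `(C^{Lt}_μΛ)(z) = −(∂⁻̃_μh)(z)·R(U_μ(z−e_μ))⁻¹Λ(z−e_μ)`. [cite: Balaban1985BackgroundPropagators, (3.100) p.413, (3.8) p.392] -/
theorem cltY_apply (U : CfgY 𝔸 i) (h : SiteY i → ℝ) (μ : Fin (d + 1)) (Λ : SiteY i → 𝔸) (z : SiteY i) :
    cltY i U h μ Λ z = -(((bdiffY i h μ z : ℝ) : ℂ) • R (UboxY i U μ ((shiftY i μ).symm z))⁻¹ (Λ ((shiftY i μ).symm z))) := by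
  rw [cltY, LinearMap.neg_apply, Pi.neg_apply, Module.End.mul_apply, cutMulY_apply, bshiftSL_apply]

/-- the averaging line, evaluated: `Σ_w avgCoeffY(z,w)(h z − h w)·R(T(z,w))Λ(w)`. [cite: Balaban1985BackgroundPropagators, (3.88) p.409; Balaban1984PropagatorsII, (2.39) p.229] -/
theorem kavgY_apply (par : SiteParY 𝔸 i) (h : SiteY i → ℝ) (U : CfgY 𝔸 i) (Λ : SiteY i → 𝔸) (z : SiteY i) :
    kavgY i par h U Λ z = ∑ w, (((avgCoeffY i z w * (h z - h w) : ℝ)) : ℂ) • R (avgTrY i par U z w) (Λ w) := by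
  rw [kavgY, kernelTrOpY_apply]

/-- `(CΛ)(z) = (Δh)(z)Λ(z) + (averaging line)`. [cite: Balaban1985BackgroundPropagators, (3.88)–(3.89) p.409] -/
theorem cKY_apply (par : SiteParY 𝔸 i) (h : SiteY i → ℝ) (U : CfgY 𝔸 i) (Λ : SiteY i → 𝔸) (z : SiteY i) :
    cKY i par h U Λ z = ((lapDiffY i h z : ℝ) : ℂ) • Λ z + kavgY i par h U Λ z := by
  rw [cKY, LinearMap.add_apply, Pi.add_apply, cutMulY_apply]

/-- `(CtΛ)(z) = (Δh)(z)Λ(z) − (averaging line)`. [cite: Balaban1985BackgroundPropagators, (3.88)–(3.89) p.409] -/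
theorem ctKY_apply (par : SiteParY 𝔸 i) (h : SiteY i → ℝ) (U : CfgY 𝔸 i) (Λ : SiteY i → 𝔸) (z : SiteY i) :
    ctKY i par h U Λ z = ((lapDiffY i h z : ℝ) : ℂ) • Λ z - kavgY i par h U Λ z := by
  rw [ctKY, LinearMap.sub_apply, Pi.sub_apply, cutMulY_apply]

/-! ## §2 Pointwise sizes (contraction pairs) -/

/-- ★ `‖(P_μΛ)(z)‖ ≤ |∂⁺_μh(z)|·‖Λ(z)‖ + |∂⁻̃_μh(z)|·‖Λ(z−e_μ)‖`. [cite: Balaban1985BackgroundPropagators, (3.88)–(3.89) p.409; Balaban1984PropagatorsII, (2.40) p.230] -/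
theorem norm_pKY_apply_le (U : CfgY 𝔸 i) (h : SiteY i → ℝ) (μ : Fin (d + 1)) (Λ : SiteY i → 𝔸) (z : SiteY i)
    (hU : ∀ w : SiteY i, ‖(UboxY i U μ w : 𝔸)‖ ≤ 1 ∧ ‖(((UboxY i U μ w)⁻¹ : 𝔸ˣ) : 𝔸)‖ ≤ 1) :
    ‖pKY i U h μ Λ z‖ ≤ |fdiffY i h μ z| * ‖Λ z‖ + |bdiffY i h μ z| * ‖Λ ((shiftY i μ).symm z)‖ := by
  rw [pKY_apply]
  refine le_trans (norm_sub_le _ _) (add_le_add ?_ ?_)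
  · rw [norm_ofReal_smul]
  · rw [norm_ofReal_smul]
    refine mul_le_mul_of_nonneg_left (norm_R_le_of_pair _ ?_ ?_ _) (abs_nonneg _)
    · exact (hU ((shiftY i μ).symm z)).2
    · rw [inv_inv]; exact (hU ((shiftY i μ).symm z)).1

/-- ★ `‖(Pt_μΛ)(z)‖ ≤ |∂⁺_μh(z)|·(‖Λ(z+e_μ)‖ + ‖Λ(z)‖)`. [cite: Balaban1985BackgroundPropagators, (3.88)–(3.89) p.409; Balaban1984PropagatorsII, (2.40) p.230] -/
theorem norm_ptKY_apply_le (U : CfgY 𝔸 i) (h : SiteY i → ℝ) (μ : Fin (d + 1)) (Λ : SiteY i → 𝔸) (z : SiteY i)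
    (hU : ∀ w : SiteY i, ‖(UboxY i U μ w : 𝔸)‖ ≤ 1 ∧ ‖(((UboxY i U μ w)⁻¹ : 𝔸ˣ) : 𝔸)‖ ≤ 1) :
    ‖ptKY i U h μ Λ z‖ ≤ |fdiffY i h μ z| * (‖Λ (shiftY i μ z)‖ + ‖Λ z‖) := by
  rw [ptKY_apply, norm_ofReal_smul]
  refine mul_le_mul_of_nonneg_left (le_trans (norm_add_le _ _) (add_le_add ?_ le_rfl)) (abs_nonneg _)
  exact norm_R_le_of_pair _ (hU z).1 (hU z).2 _

/-- ★ `‖(C^{Lt}_μΛ)(z)‖ ≤ |∂⁻̃_μh(z)|·‖Λ(z−e_μ)‖`. [cite: Balaban1985BackgroundPropagators, (3.100) p.413] -/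
theorem norm_cltY_apply_le (U : CfgY 𝔸 i) (h : SiteY i → ℝ) (μ : Fin (d + 1)) (Λ : SiteY i → 𝔸) (z : SiteY i)
    (hU : ∀ w : SiteY i, ‖(UboxY i U μ w : 𝔸)‖ ≤ 1 ∧ ‖(((UboxY i U μ w)⁻¹ : 𝔸ˣ) : 𝔸)‖ ≤ 1) :
    ‖cltY i U h μ Λ z‖ ≤ |bdiffY i h μ z| * ‖Λ ((shiftY i μ).symm z)‖ := by
  rw [cltY_apply, norm_neg, norm_ofReal_smul]
  refine mul_le_mul_of_nonneg_left (norm_R_le_of_pair _ ?_ ?_ _) (abs_nonneg _)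
  · exact (hU ((shiftY i μ).symm z)).2
  · rw [inv_inv]; exact (hU ((shiftY i μ).symm z)).1

/-- ★ the averaging line: `‖(kavgY Λ)(z)‖ ≤ Σ_w |avgCoeffY(z,w)|·|h z − h w|·‖Λ w‖`. [cite: Balaban1985BackgroundPropagators, (3.88)–(3.89) p.409; Balaban1984PropagatorsII, (2.39)–(2.40) pp.229–230] -/
theorem norm_kavgY_apply_le (par : SiteParY 𝔸 i) (h : SiteY i → ℝ) (U : CfgY 𝔸 i) (Λ : SiteY i → 𝔸) (z : SiteY i)
    (hT : ∀ w : SiteY i, ‖(avgTrY i par U z w : 𝔸)‖ ≤ 1 ∧ ‖(((avgTrY i par U z w)⁻¹ : 𝔸ˣ) : 𝔸)‖ ≤ 1) :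
    ‖kavgY i par h U Λ z‖ ≤ ∑ w, |avgCoeffY i z w| * |h z - h w| * ‖Λ w‖ := by
  rw [kavgY_apply]
  refine le_trans (norm_sum_le _ _) (Finset.sum_le_sum fun w _ => ?_)
  rw [norm_ofReal_smul, abs_mul]
  exact mul_le_mul_of_nonneg_left (norm_R_le_of_pair _ (hT w).1 (hT w).2 _) (mul_nonneg (abs_nonneg _) (abs_nonneg _))

/-- ★ `‖(CΛ)(z)‖ ≤ |Δh(z)|·‖Λ z‖ + Σ_w |avgCoeffY(z,w)|·|h z − h w|·‖Λ w‖`. [cite: Balaban1985BackgroundPropagators, (3.88)–(3.89) p.409] -/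
theorem norm_cKY_apply_le (par : SiteParY 𝔸 i) (h : SiteY i → ℝ) (U : CfgY 𝔸 i) (Λ : SiteY i → 𝔸) (z : SiteY i)
    (hT : ∀ w : SiteY i, ‖(avgTrY i par U z w : 𝔸)‖ ≤ 1 ∧ ‖(((avgTrY i par U z w)⁻¹ : 𝔸ˣ) : 𝔸)‖ ≤ 1) :
    ‖cKY i par h U Λ z‖ ≤ |lapDiffY i h z| * ‖Λ z‖ + ∑ w, |avgCoeffY i z w| * |h z - h w| * ‖Λ w‖ := by
  rw [cKY_apply]
  refine le_trans (norm_add_le _ _) (add_le_add ?_ (norm_kavgY_apply_le i par h U Λ z hT))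
  rw [norm_ofReal_smul]

/-- ★ `‖(CtΛ)(z)‖ ≤ |Δh(z)|·‖Λ z‖ + Σ_w |avgCoeffY(z,w)|·|h z − h w|·‖Λ w‖`. [cite: Balaban1985BackgroundPropagators, (3.88)–(3.89) p.409] -/
theorem norm_ctKY_apply_le (par : SiteParY 𝔸 i) (h : SiteY i → ℝ) (U : CfgY 𝔸 i) (Λ : SiteY i → 𝔸) (z : SiteY i)
    (hT : ∀ w : SiteY i, ‖(avgTrY i par U z w : 𝔸)‖ ≤ 1 ∧ ‖(((avgTrY i par U z w)⁻¹ : 𝔸ˣ) : 𝔸)‖ ≤ 1) :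
    ‖ctKY i par h U Λ z‖ ≤ |lapDiffY i h z| * ‖Λ z‖ + ∑ w, |avgCoeffY i z w| * |h z - h w| * ‖Λ w‖ := by
  rw [ctKY_apply]
  refine le_trans (norm_sub_le _ _) (add_le_add ?_ (norm_kavgY_apply_le i par h U Λ z hT))
  rw [norm_ofReal_smul]

/-! ## §3 Sizes against one local bound of `‖Λ‖` over the stencil of `z` -/

/-- `‖(P_μΛ)(z)‖ ≤ (|∂⁺_μh(z)| + |∂⁻̃_μh(z)|)·B` for `‖Λ‖ ≤ B` on the stencil of `z`. [cite: Balaban1985BackgroundPropagators, (3.89) p.409] -/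
theorem norm_pKY_apply_le_of_bound (U : CfgY 𝔸 i) (h : SiteY i → ℝ) (μ : Fin (d + 1)) (Λ : SiteY i → 𝔸) (z : SiteY i)
    (hU : ∀ w : SiteY i, ‖(UboxY i U μ w : 𝔸)‖ ≤ 1 ∧ ‖(((UboxY i U μ w)⁻¹ : 𝔸ˣ) : 𝔸)‖ ≤ 1)
    {B : ℝ} (hB : ∀ w ∈ stencilY i z, ‖Λ w‖ ≤ B) :
    ‖pKY i U h μ Λ z‖ ≤ (|fdiffY i h μ z| + |bdiffY i h μ z|) * B := by
  refine le_trans (norm_pKY_apply_le i U h μ Λ z hU) ?_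
  rw [add_mul]
  exact add_le_add (mul_le_mul_of_nonneg_left (hB z (self_mem_stencilY i z)) (abs_nonneg _))
    (mul_le_mul_of_nonneg_left (hB _ (shiftY_symm_mem_stencilY i z μ)) (abs_nonneg _))

/-- `‖(Pt_μΛ)(z)‖ ≤ 2|∂⁺_μh(z)|·B` for `‖Λ‖ ≤ B` on the stencil of `z`. [cite: Balaban1985BackgroundPropagators, (3.89) p.409] -/
theorem norm_ptKY_apply_le_of_bound (U : CfgY 𝔸 i) (h : SiteY i → ℝ) (μ : Fin (d + 1)) (Λ : SiteY i → 𝔸) (z : SiteY i)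
    (hU : ∀ w : SiteY i, ‖(UboxY i U μ w : 𝔸)‖ ≤ 1 ∧ ‖(((UboxY i U μ w)⁻¹ : 𝔸ˣ) : 𝔸)‖ ≤ 1)
    {B : ℝ} (hB : ∀ w ∈ stencilY i z, ‖Λ w‖ ≤ B) :
    ‖ptKY i U h μ Λ z‖ ≤ 2 * |fdiffY i h μ z| * B := by
  refine le_trans (norm_ptKY_apply_le i U h μ Λ z hU) ?_
  have h1 := hB _ (shiftY_mem_stencilY i z μ)
  have h2 := hB z (self_mem_stencilY i z)
  calc |fdiffY i h μ z| * (‖Λ (shiftY i μ z)‖ + ‖Λ z‖) ≤ |fdiffY i h μ z| * (B + B) :=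
        mul_le_mul_of_nonneg_left (add_le_add h1 h2) (abs_nonneg _)
    _ = 2 * |fdiffY i h μ z| * B := by ring

/-- `‖(C^{Lt}_μΛ)(z)‖ ≤ |∂⁻̃_μh(z)|·B` for `‖Λ‖ ≤ B` on the stencil of `z`. [cite: Balaban1985BackgroundPropagators, (3.100) p.413] -/
theorem norm_cltY_apply_le_of_bound (U : CfgY 𝔸 i) (h : SiteY i → ℝ) (μ : Fin (d + 1)) (Λ : SiteY i → 𝔸) (z : SiteY i)
    (hU : ∀ w : SiteY i, ‖(UboxY i U μ w : 𝔸)‖ ≤ 1 ∧ ‖(((UboxY i U μ w)⁻¹ : 𝔸ˣ) : 𝔸)‖ ≤ 1)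
    {B : ℝ} (hB : ∀ w ∈ stencilY i z, ‖Λ w‖ ≤ B) :
    ‖cltY i U h μ Λ z‖ ≤ |bdiffY i h μ z| * B :=
  le_trans (norm_cltY_apply_le i U h μ Λ z hU)
    (mul_le_mul_of_nonneg_left (hB _ (shiftY_symm_mem_stencilY i z μ)) (abs_nonneg _))

/-- the averaging line against a stencil bound: `‖(kavgY Λ)(z)‖ ≤ (Σ_w |avgCoeffY(z,w)|·|h z − h w|)·B`.
[cite: Balaban1985BackgroundPropagators, (3.89) p.409; Balaban1984PropagatorsII, (2.40) p.230] -/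
theorem norm_kavgY_apply_le_of_bound (par : SiteParY 𝔸 i) (h : SiteY i → ℝ) (U : CfgY 𝔸 i) (Λ : SiteY i → 𝔸) (z : SiteY i)
    (hT : ∀ w : SiteY i, ‖(avgTrY i par U z w : 𝔸)‖ ≤ 1 ∧ ‖(((avgTrY i par U z w)⁻¹ : 𝔸ˣ) : 𝔸)‖ ≤ 1)
    {B : ℝ} (hB : ∀ w ∈ stencilY i z, ‖Λ w‖ ≤ B) :
    ‖kavgY i par h U Λ z‖ ≤ (∑ w, |avgCoeffY i z w| * |h z - h w|) * B := by
  refine le_trans (norm_kavgY_apply_le i par h U Λ z hT) ?_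
  rw [Finset.sum_mul]
  refine Finset.sum_le_sum fun w _ => ?_
  by_cases hw : avgCoeffY i z w = 0
  · simp [hw]
  · exact mul_le_mul_of_nonneg_left (hB w (mem_stencilY_of_avgCoeffY_ne_zero i z w hw))
      (mul_nonneg (abs_nonneg _) (abs_nonneg _))

/-- `‖(CΛ)(z)‖ ≤ (|Δh(z)| + Σ_w |avgCoeffY(z,w)|·|h z − h w|)·B` for `‖Λ‖ ≤ B` on the stencil of `z`. [cite: Balaban1985BackgroundPropagators, (3.89) p.409] -/
theorem norm_cKY_apply_le_of_bound (par : SiteParY 𝔸 i) (h : SiteY i → ℝ) (U : CfgY 𝔸 i) (Λ : SiteY i → 𝔸) (z : SiteY i)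
    (hT : ∀ w : SiteY i, ‖(avgTrY i par U z w : 𝔸)‖ ≤ 1 ∧ ‖(((avgTrY i par U z w)⁻¹ : 𝔸ˣ) : 𝔸)‖ ≤ 1)
    {B : ℝ} (hB : ∀ w ∈ stencilY i z, ‖Λ w‖ ≤ B) :
    ‖cKY i par h U Λ z‖ ≤ (|lapDiffY i h z| + ∑ w, |avgCoeffY i z w| * |h z - h w|) * B := by
  rw [cKY_apply, add_mul]
  refine le_trans (norm_add_le _ _) (add_le_add ?_ (norm_kavgY_apply_le_of_bound i par h U Λ z hT hB))
  rw [norm_ofReal_smul]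
  exact mul_le_mul_of_nonneg_left (hB z (self_mem_stencilY i z)) (abs_nonneg _)

/-- `‖(CtΛ)(z)‖ ≤ (|Δh(z)| + Σ_w |avgCoeffY(z,w)|·|h z − h w|)·B` for `‖Λ‖ ≤ B` on the stencil of `z`. [cite: Balaban1985BackgroundPropagators, (3.89) p.409] -/
theorem norm_ctKY_apply_le_of_bound (par : SiteParY 𝔸 i) (h : SiteY i → ℝ) (U : CfgY 𝔸 i) (Λ : SiteY i → 𝔸) (z : SiteY i)
    (hT : ∀ w : SiteY i, ‖(avgTrY i par U z w : 𝔸)‖ ≤ 1 ∧ ‖(((avgTrY i par U z w)⁻¹ : 𝔸ˣ) : 𝔸)‖ ≤ 1)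
    {B : ℝ} (hB : ∀ w ∈ stencilY i z, ‖Λ w‖ ≤ B) :
    ‖ctKY i par h U Λ z‖ ≤ (|lapDiffY i h z| + ∑ w, |avgCoeffY i z w| * |h z - h w|) * B := by
  rw [ctKY_apply, add_mul]
  refine le_trans (norm_sub_le _ _) (add_le_add ?_ (norm_kavgY_apply_le_of_bound i par h U Λ z hT hB))
  rw [norm_ofReal_smul]
  exact mul_le_mul_of_nonneg_left (hB z (self_mem_stencilY i z)) (abs_nonneg _)

/-! ## §4 Semi-locality: dependence on `Λ` through the stencil only, and vanishing off the support of the differences of `h` -/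

/-- `(P_μΛ)(z)` depends on `Λ` at `z` and `z − e_μ` only. [cite: Balaban1985BackgroundPropagators, p.410 («K(h) is semi-local»)] -/
theorem pKY_apply_congr (U : CfgY 𝔸 i) (h : SiteY i → ℝ) (μ : Fin (d + 1)) {Λ Λ' : SiteY i → 𝔸} {z : SiteY i}
    (h0 : Λ z = Λ' z) (h1 : Λ ((shiftY i μ).symm z) = Λ' ((shiftY i μ).symm z)) :
    pKY i U h μ Λ z = pKY i U h μ Λ' z := by
  rw [pKY_apply, pKY_apply, h0, h1]

/-- `(Pt_μΛ)(z)` depends on `Λ` at `z` and `z + e_μ` only. [cite: Balaban1985BackgroundPropagators, p.410 («K(h) is semi-local»)] -/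
theorem ptKY_apply_congr (U : CfgY 𝔸 i) (h : SiteY i → ℝ) (μ : Fin (d + 1)) {Λ Λ' : SiteY i → 𝔸} {z : SiteY i}
    (h0 : Λ z = Λ' z) (h1 : Λ (shiftY i μ z) = Λ' (shiftY i μ z)) :
    ptKY i U h μ Λ z = ptKY i U h μ Λ' z := by
  rw [ptKY_apply, ptKY_apply, h0, h1]

/-- `(C^{Lt}_μΛ)(z)` depends on `Λ` at `z − e_μ` only. [cite: Balaban1985BackgroundPropagators, (3.100) p.413, bookkeeping] -/
theorem cltY_apply_congr (U : CfgY 𝔸 i) (h : SiteY i → ℝ) (μ : Fin (d + 1)) {Λ Λ' : SiteY i → 𝔸} {z : SiteY i}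
    (h1 : Λ ((shiftY i μ).symm z) = Λ' ((shiftY i μ).symm z)) :
    cltY i U h μ Λ z = cltY i U h μ Λ' z := by
  rw [cltY_apply, cltY_apply, h1]

/-- the averaging line at `z` depends on `Λ` on the block of `z` (the support of `avgCoeffY i z ·`) only.
[cite: Balaban1985BackgroundPropagators, p.410 («K(h) is semi-local»); Balaban1984PropagatorsII, (2.39) p.229] -/
theorem kavgY_apply_congr (par : SiteParY 𝔸 i) (h : SiteY i → ℝ) (U : CfgY 𝔸 i) {Λ Λ' : SiteY i → 𝔸} {z : SiteY i}
    (hΛ : ∀ w, avgCoeffY i z w ≠ 0 → Λ w = Λ' w) :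
    kavgY i par h U Λ z = kavgY i par h U Λ' z := by
  rw [kavgY_apply, kavgY_apply]
  refine Finset.sum_congr rfl fun w _ => ?_
  by_cases hw : avgCoeffY i z w = 0
  · simp [hw]
  · rw [hΛ w hw]

/-- every letter at `z` depends on `Λ` on the stencil of `z` only — here `C`. [cite: Balaban1985BackgroundPropagators, p.410 («K(h) is semi-local»)] -/
theorem cKY_apply_congr (par : SiteParY 𝔸 i) (h : SiteY i → ℝ) (U : CfgY 𝔸 i) {Λ Λ' : SiteY i → 𝔸} {z : SiteY i}
    (hΛ : ∀ w ∈ stencilY i z, Λ w = Λ' w) :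
    cKY i par h U Λ z = cKY i par h U Λ' z := by
  rw [cKY_apply, cKY_apply, hΛ z (self_mem_stencilY i z),
    kavgY_apply_congr i par h U fun w hw => hΛ w (mem_stencilY_of_avgCoeffY_ne_zero i z w hw)]

/-- … and `Ct`. [cite: Balaban1985BackgroundPropagators, p.410 («K(h) is semi-local»)] -/
theorem ctKY_apply_congr (par : SiteParY 𝔸 i) (h : SiteY i → ℝ) (U : CfgY 𝔸 i) {Λ Λ' : SiteY i → 𝔸} {z : SiteY i}
    (hΛ : ∀ w ∈ stencilY i z, Λ w = Λ' w) :
    ctKY i par h U Λ z = ctKY i par h U Λ' z := by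
  rw [ctKY_apply, ctKY_apply, hΛ z (self_mem_stencilY i z),
    kavgY_apply_congr i par h U fun w hw => hΛ w (mem_stencilY_of_avgCoeffY_ne_zero i z w hw)]

/-- … and `P_μ`, `Pt_μ`, `C^{Lt}_μ` against the whole stencil (uniform form). [cite: Balaban1985BackgroundPropagators, p.410 («K(h) is semi-local»)] -/
theorem pKY_apply_congr_stencil (U : CfgY 𝔸 i) (h : SiteY i → ℝ) (μ : Fin (d + 1)) {Λ Λ' : SiteY i → 𝔸} {z : SiteY i}
    (hΛ : ∀ w ∈ stencilY i z, Λ w = Λ' w) : pKY i U h μ Λ z = pKY i U h μ Λ' z :=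
  pKY_apply_congr i U h μ (hΛ z (self_mem_stencilY i z)) (hΛ _ (shiftY_symm_mem_stencilY i z μ))

/-- (uniform form for `Pt_μ`). [cite: Balaban1985BackgroundPropagators, p.410 («K(h) is semi-local»)] -/
theorem ptKY_apply_congr_stencil (U : CfgY 𝔸 i) (h : SiteY i → ℝ) (μ : Fin (d + 1)) {Λ Λ' : SiteY i → 𝔸} {z : SiteY i}
    (hΛ : ∀ w ∈ stencilY i z, Λ w = Λ' w) : ptKY i U h μ Λ z = ptKY i U h μ Λ' z :=
  ptKY_apply_congr i U h μ (hΛ z (self_mem_stencilY i z)) (hΛ _ (shiftY_mem_stencilY i z μ))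

/-- (uniform form for `C^{Lt}_μ`). [cite: Balaban1985BackgroundPropagators, (3.100) p.413, bookkeeping] -/
theorem cltY_apply_congr_stencil (U : CfgY 𝔸 i) (h : SiteY i → ℝ) (μ : Fin (d + 1)) {Λ Λ' : SiteY i → 𝔸} {z : SiteY i}
    (hΛ : ∀ w ∈ stencilY i z, Λ w = Λ' w) : cltY i U h μ Λ z = cltY i U h μ Λ' z :=
  cltY_apply_congr i U h μ (hΛ _ (shiftY_symm_mem_stencilY i z μ))

/-- ★ OUTPUT LOCALISATION of `P_μ`: `(P_μΛ)(z) = 0` where both bond differences of `h` at `z` in direction `μ` vanish (so `P_μ(U,h_□)Λ` is supported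
on the `μ`-bond stencil of `supp ∂h_□ ⊂ □̃`). [cite: Balaban1985BackgroundPropagators, p.410 («depends on U restricted to …»), (3.89) p.409] -/
theorem pKY_apply_eq_zero (U : CfgY 𝔸 i) (h : SiteY i → ℝ) (μ : Fin (d + 1)) (Λ : SiteY i → 𝔸) {z : SiteY i}
    (h0 : fdiffY i h μ z = 0) (h1 : bdiffY i h μ z = 0) : pKY i U h μ Λ z = 0 := by
  rw [pKY_apply, h0, h1, Complex.ofReal_zero, zero_smul, zero_smul, sub_zero]

/-- output localisation of `Pt_μ`: zero where `∂⁺_μh(z) = 0`. [cite: Balaban1985BackgroundPropagators, p.410, (3.89) p.409] -/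
theorem ptKY_apply_eq_zero (U : CfgY 𝔸 i) (h : SiteY i → ℝ) (μ : Fin (d + 1)) (Λ : SiteY i → 𝔸) {z : SiteY i}
    (h0 : fdiffY i h μ z = 0) : ptKY i U h μ Λ z = 0 := by
  rw [ptKY_apply, h0, Complex.ofReal_zero, zero_smul]

/-- output localisation of `C^{Lt}_μ`: zero where `∂⁻̃_μh(z) = 0`. [cite: Balaban1985BackgroundPropagators, (3.100) p.413, bookkeeping] -/
theorem cltY_apply_eq_zero (U : CfgY 𝔸 i) (h : SiteY i → ℝ) (μ : Fin (d + 1)) (Λ : SiteY i → 𝔸) {z : SiteY i}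
    (h1 : bdiffY i h μ z = 0) : cltY i U h μ Λ z = 0 := by
  rw [cltY_apply, h1, Complex.ofReal_zero, zero_smul, neg_zero]

/-- output localisation of the averaging line: zero at `z` when `h` is constant on the block of `z`.
[cite: Balaban1985BackgroundPropagators, p.410; Balaban1984PropagatorsII, (2.39) p.229] -/
theorem kavgY_apply_eq_zero (par : SiteParY 𝔸 i) (h : SiteY i → ℝ) (U : CfgY 𝔸 i) (Λ : SiteY i → 𝔸) {z : SiteY i}
    (hc : ∀ w, avgCoeffY i z w ≠ 0 → h w = h z) : kavgY i par h U Λ z = 0 := by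
  rw [kavgY_apply]
  refine Finset.sum_eq_zero fun w _ => ?_
  by_cases hw : avgCoeffY i z w = 0
  · simp [hw]
  · rw [hc w hw, sub_self, mul_zero, Complex.ofReal_zero, zero_smul]

/-- output localisation of `C`: zero at `z` when `Δh(z) = 0` and `h` is constant on the block of `z`. [cite: Balaban1985BackgroundPropagators, p.410, (3.89) p.409] -/
theorem cKY_apply_eq_zero (par : SiteParY 𝔸 i) (h : SiteY i → ℝ) (U : CfgY 𝔸 i) (Λ : SiteY i → 𝔸) {z : SiteY i}
    (hL : lapDiffY i h z = 0) (hc : ∀ w, avgCoeffY i z w ≠ 0 → h w = h z) : cKY i par h U Λ z = 0 := by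
  rw [cKY_apply, hL, kavgY_apply_eq_zero i par h U Λ hc, Complex.ofReal_zero, zero_smul, add_zero]

/-- output localisation of `Ct`: likewise. [cite: Balaban1985BackgroundPropagators, p.410, (3.89) p.409] -/
theorem ctKY_apply_eq_zero (par : SiteParY 𝔸 i) (h : SiteY i → ℝ) (U : CfgY 𝔸 i) (Λ : SiteY i → 𝔸) {z : SiteY i}
    (hL : lapDiffY i h z = 0) (hc : ∀ w, avgCoeffY i z w ≠ 0 → h w = h z) : ctKY i par h U Λ z = 0 := by
  rw [ctKY_apply, hL, kavgY_apply_eq_zero i par h U Λ hc, Complex.ofReal_zero, zero_smul, sub_zero]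

end Letters

end Literature.MathematicalPhysics.QuantumFieldTheory.Balaban1983to89.Node00.OpsYLeibnizLettersSizes
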